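import Summits.QuantumFields.YangMills.Theorems.BalabanUVNodesK0Stub3NormalisationTokenBlind
import Literature.MathematicalPhysics.QuantumFieldTheory.Balaban1983to89.Node00.Record13NumericsOfThm1CCMZ

/-!
# K0⁷ — STUB 3 LANE AT THE z-WITNESSES `θ₁₅ᶜᶜᴹᶻ ∕ θ₁₅ᶜᶜᴹᵂᶻ` (def-1 Z2 `Node00.Record13NumericsOfThm1CCMZ`): the β of record of the z-witness IS the β of the collared witness (`rfl`);
# V19's registered socket text ⟺ boxes at the z-witnesses for ANY tokens `Efl`, `logz`; the window edition at `θ₁₅ᶜᶜᴹᵂᶻ`; K0⁷ BY NAME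

Cell `pub-ymgap`, width seat `pub-ymgap-k0-s3-w1` (g0-0; CLAIM-2 §3 I.38795 — «keyed at `theta13OfThm1CCMZ` the hour Z2 is in the tree»).  `--kind proof --supports stmt-QuantumFields-20541 --as helper`,
COUNT-NEUTRAL.  NEW leaf; theorems only — 0 `def`, 0 `sorry`.  Imports this seat's `…K0Stub3NormalisationTokenBlind` (p639725 ✓) and def-1's Z2 `Node00.Record13NumericsOfThm1CCMZ` (the z-witness
makers `theta13OfThm1CCMZ F N j ε₀ ε₂₉ B₃ B₃' a₀ a₁ Efl logz`, `theta13OfThm1CCMWZ F N j γ ε₀ ε₂₉ B₃ B₃' a₀ a₁ Efl logz`, bridges `theta13OfThm1CCM_eq_Z` ∕ `…CCMW_eq_Z` at the zero tokens).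
[I] = [Balaban1987RG1]; [III] = [Balaban1988Convergent]; [V] = [Balaban1989LargeFieldI].

WHY (FLAG №9, director-ym №218 (3) «mechanical re-keys»).  The z-witness carries print's normalisation tokens `E_k`, `log z_k` ([III] (1.15)) where K0a's family had `0, 0`; the β-layer does not read
them (p639725 §1), so at the z-witnesses the β of record — hence every box ∕ run ∕ comparability letter of the stub-3 lane — is the collared witness's, by `rfl`.  This file states it at the
MAKERS OF RECORD and re-points the socket payers: a NODE O ∕ N22 supplier delivering boxes at `θ₁₅ᶜᶜᴹᶻ(j; …; E, ℓ)` or own-window boxes at `θ₁₅ᶜᶜᴹᵂᶻ(j; γ₀; …; E, ℓ)` pays V19's text (and,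
through k0-s3-w2's token-free adapters, V20-G's) with NO re-typing of the lane.

CONTENTS.  §1 `betaOfRecord₁₃_theta13OfThm1CCMZ` · `betaOfRecord₁₃_theta13OfThm1CCMWZ` · `gOfRecord₁₃_theta13OfThm1CCMZ` (`rfl`); §2 ★★ `abs3A'_iff_boxAtZWitness` · ★★ `abs3A'_of_ownWindowBoxAtZWindowWitness` ·
★★ `record13SepCoPHInhabited_of_stub1_boxAtZWitness_byName`.

HONEST FRAMING (binding).  `rfl`-level typing facts + by-name transfers; NO β estimate; NO value of `E_k` ∕ `log z_k` pinned or used (the tokens are free binders); nothing of Bałaban asserted;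
FLAG №9 NOT closed by this (№218 (4)); stub 3ᴬ′ (V19 ∕ V20-G) NOT proved; K0⁷ stmt-QuantumFields-20541 OPEN (V20-G dead8a8df885c226 stands); counts unmoved (typed 28∕28 · discharged 5∕27 — the
chair's words); no summit statement is proved by this seat; R4 = the CONDITIONAL finite-𝕋⁴ rung `BalabanLadder.UV` only — NOT continuum ∕ ℝ⁴ ∕ OS ∕ mass gap ∕ Clay.  No `sorry`, `def`,
`instance`, `notation`, `axiom`; standard axioms.
-/

noncomputable section

open scoped Matrix.Norms.L2Operator

namespace Summit.QuantumFields.YangMills.Theorems.K0Stub3ZWitnessBlind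

open Literature.MathematicalPhysics.QuantumFieldTheory.Balaban1983to89
open Literature.MathematicalPhysics.QuantumFieldTheory.Balaban1983to89.Node00
open Literature.MathematicalPhysics.QuantumFieldTheory.Balaban1983to89.T4Continuum
open Literature.MathematicalPhysics.QuantumFieldTheory.Balaban1983to89.FlowStep
open Summit.QuantumFields.YangMills.Theorems.K0V19Defs (Prop8StepCoPAt AbsBetaBoxAtThm1WitnessCCMGenAt)
open Summit.QuantumFields.YangMills.Theorems.K0V19Stub2Prime (record13SepCoPHInhabited_of_stub1_stub3A'_byName)
open Summit.QuantumFields.YangMills.Theorems.K0Stub3SocketWindowEdition (abs3A'_of_ownWindowBoxAt)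

/-! ## §1  The z-witnesses carry the β (and the generated runs) of the collared witnesses (`rfl`) -/

section Beta

variable (F : T4Family) (N : ℕ) [NeZero N] (j : ℕ) (γ ε₀ ε₂₉ B₃ B₃' a₀ a₁ : ℝ) (Efl logz : B12.RunParams → ℕ → ℝ)

/-- **★ β OF THE z-WITNESS = β OF THE COLLARED WITNESS** (`rfl`; the β-layer does not read `Efl`, `logz`). [cite: Balaban1987RG1, (1.20)–(1.22) p.264; Balaban1988Convergent, (1.15) p.249; Balaban1989LargeFieldI, (0.3) p.176 (bookkeeping)] -/
theorem betaOfRecord₁₃_theta13OfThm1CCMZ :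
    betaOfRecord₁₃ F N (theta13OfThm1CCMZ F N j ε₀ ε₂₉ B₃ B₃' a₀ a₁ Efl logz) = betaOfRecord₁₃ F N (theta13OfThm1CCM F N j ε₀ ε₂₉ B₃ B₃' a₀ a₁) := rfl

/-- **… and for the windowed z-witness** (`rfl`). [cite: Balaban1987RG1, (1.20)–(1.22) p.264; Balaban1989LargeFieldI, (0.3) p.176 (bookkeeping)] -/
theorem betaOfRecord₁₃_theta13OfThm1CCMWZ :
    betaOfRecord₁₃ F N (theta13OfThm1CCMWZ F N j γ ε₀ ε₂₉ B₃ B₃' a₀ a₁ Efl logz) = betaOfRecord₁₃ F N (theta13OfThm1CCMW F N j γ ε₀ ε₂₉ B₃ B₃' a₀ a₁) := rfl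

/-- Hence the GENERATED RUNS of the z-witness are the collared witness's (`rfl`). [cite: Balaban1987RG1, (0.17)–(0.20) pp.255–256 (bookkeeping)] -/
theorem gOfRecord₁₃_theta13OfThm1CCMZ :
    gOfRecord₁₃ F N (theta13OfThm1CCMZ F N j ε₀ ε₂₉ B₃ B₃' a₀ a₁ Efl logz) = gOfRecord₁₃ F N (theta13OfThm1CCM F N j ε₀ ε₂₉ B₃ B₃' a₀ a₁) := rfl

end Beta

/-! ## §2  The registered socket text from boxes at the z-witnesses; K0⁷ BY NAME -/

section Socket

variable (F : T4Family)

/-- **★★ V19's SOCKET TEXT ⟺ BOXES AT THE z-WITNESS FOR SOME (equivalently ANY) TOKENS `Efl`, `logz`** per admissible tuple — both directions the identity on the box (§1).  So the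
FLAG №9-cured witness serves the K0 socket verbatim. [cite: Balaban1987RG1, Thm 1 p.255, (1.20)–(1.22) p.264, §1 p.264; Balaban1985Variational, Thm 1 (8)–(9) p.279; Balaban1988Convergent, (1.15) p.249, Thm 1 p.262; Balaban1989LargeFieldI, (0.3) p.176] -/
theorem abs3A'_iff_boxAtZWitness :
    AbsBetaBoxAtThm1WitnessCCMGenAt F ↔
      ∀ (j c : ℕ) (B₃ B₃' a₀ a₁ : ℝ), c ≤ F.L ^ j → 2 * (F.L : ℝ) ^ 2 ≤ B₃ → 0 < B₃' → 0 < a₀ → 0 < a₁ →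
        VariationalThm1RegSepCoP7M F 2 B₃ a₀ a₁ →
        Gauge9RegSepTopStepR F 2 (fun ν K Ω => suppDomOfRecord F ν K Ω) (F.L ^ j) c B₃ B₃' a₀ a₁ →
        ∃ (Efl logz : B12.RunParams → ℕ → ℝ) (γ₀ ε₀ ε₂₉ β' : ℝ), 0 < γ₀ ∧ 0 < ε₀ ∧ 0 < ε₂₉ ∧
          BetaLowerH (-β') γ₀ (betaOfRecord₁₃ F 2 (theta13OfThm1CCMZ F 2 j ε₀ ε₂₉ B₃ B₃' a₀ a₁ Efl logz)) ∧
          BetaUpperH β' γ₀ (betaOfRecord₁₃ F 2 (theta13OfThm1CCMZ F 2 j ε₀ ε₂₉ B₃ B₃' a₀ a₁ Efl logz)) := by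
  constructor
  · intro h j c B₃ B₃' a₀ a₁ hc hB hB' ha₀ ha₁ h15 h9
    obtain ⟨γ₀, ε₀, ε₂₉, β', hγ₀, hε, hε', hlow, hup⟩ := h j c B₃ B₃' a₀ a₁ hc hB hB' ha₀ ha₁ h15 h9
    exact ⟨fun _ _ => 0, fun _ _ => 0, γ₀, ε₀, ε₂₉, β', hγ₀, hε, hε', hlow, hup⟩
  · intro h j c B₃ B₃' a₀ a₁ hc hB hB' ha₀ ha₁ h15 h9
    obtain ⟨E, ℓ, γ₀, ε₀, ε₂₉, β', hγ₀, hε, hε', hlow, hup⟩ := h j c B₃ B₃' a₀ a₁ hc hB hB' ha₀ ha₁ h15 h9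
    exact ⟨γ₀, ε₀, ε₂₉, β', hγ₀, hε, hε', hlow, hup⟩

/-- **★★ THE WINDOW EDITION AT THE WINDOWED z-WITNESS**: own-window boxes of `θ₁₅ᶜᶜᴹᵂᶻ(j; γ₀; …; Efl, logz)`, `0 < γ₀ ≤ ½`, for SOME tokens and thresholds per admissible tuple ⟹ V19's text
(§1 + p618788 `abs3A'_of_ownWindowBoxAt`) — the shape a θ-generic road run at the small-window z-RECORD returns.  CONDITIONAL on the boxes. [cite: Balaban1987RG1, Thm 1 p.255, (1.20)–(1.22) p.264, §1 p.264; Balaban1989LargeFieldII, (1.4) p.357; Balaban1989LargeFieldI, (0.3) p.176] -/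
theorem abs3A'_of_ownWindowBoxAtZWindowWitness
    (h : ∀ (j c : ℕ) (B₃ B₃' a₀ a₁ : ℝ), c ≤ F.L ^ j → 2 * (F.L : ℝ) ^ 2 ≤ B₃ → 0 < B₃' → 0 < a₀ → 0 < a₁ →
      VariationalThm1RegSepCoP7M F 2 B₃ a₀ a₁ →
      Gauge9RegSepTopStepR F 2 (fun ν K Ω => suppDomOfRecord F ν K Ω) (F.L ^ j) c B₃ B₃' a₀ a₁ →
      ∃ (Efl logz : B12.RunParams → ℕ → ℝ) (γ₀ ε₀ ε₂₉ β' : ℝ), 0 < γ₀ ∧ γ₀ ≤ 1 / 2 ∧ 0 < ε₀ ∧ 0 < ε₂₉ ∧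
        BetaLowerH (-β') (theta13OfThm1CCMWZ F 2 j γ₀ ε₀ ε₂₉ B₃ B₃' a₀ a₁ Efl logz).γ (betaOfRecord₁₃ F 2 (theta13OfThm1CCMWZ F 2 j γ₀ ε₀ ε₂₉ B₃ B₃' a₀ a₁ Efl logz)) ∧
        BetaUpperH β' (theta13OfThm1CCMWZ F 2 j γ₀ ε₀ ε₂₉ B₃ B₃' a₀ a₁ Efl logz).γ (betaOfRecord₁₃ F 2 (theta13OfThm1CCMWZ F 2 j γ₀ ε₀ ε₂₉ B₃ B₃' a₀ a₁ Efl logz))) :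
    AbsBetaBoxAtThm1WitnessCCMGenAt F := by
  refine abs3A'_of_ownWindowBoxAt F fun j c B₃ B₃' a₀ a₁ hc hB hB' ha₀ ha₁ h15 h9 => ?_
  obtain ⟨E, ℓ, γ₀, ε₀, ε₂₉, β', hγ₀, hγh, hε, hε', hlow, hup⟩ := h j c B₃ B₃' a₀ a₁ hc hB hB' ha₀ ha₁ h15 h9
  rw [theta13OfThm1CCMWZ_γ] at hlow hup
  refine ⟨γ₀, ε₀, ε₂₉, β', hγ₀, hγh, hε, hε', ?_, ?_⟩
  · rw [theta13OfThm1CCMW_γ]; exact hlow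
  · rw [theta13OfThm1CCMW_γ]; exact hup

/-- **★★ K0⁷ BY NAME FROM V19's STUB-1 TEXT AND BOXES AT THE z-WITNESSES** (stub 2′ by name inside `K0V19Stub2Prime.record13SepCoPHInhabited_of_stub1_stub3A'_byName`, p595104; under V20-G feed
k0-s3-w2's `K0Stub3V20GSockets` through the token-free core).  CONDITIONAL on `h1` and the boxes; K0⁷ OPEN; a helper, not a closer. [cite: Balaban1985Variational, Thm 1 (8)–(9) p.279, Prop. 8 p.304; Balaban1985RegularSpaces, Prop. 6 p.99; Balaban1988Convergent, (1.15) p.249, Thm 1 p.262; Balaban1987RG1, Thm 1 p.255, §1 p.264; Balaban1989LargeFieldI, (0.3) p.176] -/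
theorem record13SepCoPHInhabited_of_stub1_boxAtZWitness_byName (h1 : ∀ F : T4Family, Prop8StepCoPAt F)
    (h : ∀ (F : T4Family) (j c : ℕ) (B₃ B₃' a₀ a₁ : ℝ), c ≤ F.L ^ j → 2 * (F.L : ℝ) ^ 2 ≤ B₃ → 0 < B₃' → 0 < a₀ → 0 < a₁ →
      VariationalThm1RegSepCoP7M F 2 B₃ a₀ a₁ →
      Gauge9RegSepTopStepR F 2 (fun ν K Ω => suppDomOfRecord F ν K Ω) (F.L ^ j) c B₃ B₃' a₀ a₁ →
      ∃ (Efl logz : B12.RunParams → ℕ → ℝ) (γ₀ ε₀ ε₂₉ β' : ℝ), 0 < γ₀ ∧ 0 < ε₀ ∧ 0 < ε₂₉ ∧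
        BetaLowerH (-β') γ₀ (betaOfRecord₁₃ F 2 (theta13OfThm1CCMZ F 2 j ε₀ ε₂₉ B₃ B₃' a₀ a₁ Efl logz)) ∧
        BetaUpperH β' γ₀ (betaOfRecord₁₃ F 2 (theta13OfThm1CCMZ F 2 j ε₀ ε₂₉ B₃ B₃' a₀ a₁ Efl logz))) :
    Summit.QuantumFields.YangMills.Theses.BalabanUVNodes.Record13SepCoPHInhabited :=
  record13SepCoPHInhabited_of_stub1_stub3A'_byName h1 fun F => (abs3A'_iff_boxAtZWitness F).2 (h F)

end Socket

end Summit.QuantumFields.YangMills.Theorems.K0Stub3ZWitnessBlind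

end
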